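import Summits.Ventures.AbcSig.Sieve.EisensteinFast
import Summits.Ventures.AbcSig.Recipes.EisPackage

/-!
# Venture AbcSig — the M6χ exclusion (Eisenstein congruence with a character pair): NAMED HYPOTHESIS and discharge

HONEST FRAMING. Interface + glue file of a COMPUTATION cell (`pub-abcsig`). No Diophantine statement is proved here and
nothing is a claim on ABC or any summit. This is the twin of `Recipes/EisPackage.lean` (module M6) for the cell's
module M6χ (lead ruling M6χ ADMISSIBLE, 2026-08-22T20:15:48Z; engine-2 record `engine/engine-2/results/M6chi/`,
referee second implementation `referee/m6chi-g17/` 14/14, lit pin `lit/M6CHI-PIN.md`): "the surviving prime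
`𝔫 = (n, θ − r)` of an orbit is Eisenstein WITH A QUADRATIC CHARACTER PAIR: `f ≡ Σ_t λ_t E_χ(tz) (mod 𝔫)` to the
Sturm bound, `E_χ = ½E₂^{χ,χ}`, `χ = (·/C)`, `C² ∣ N`; hence `c_p(f) ≡ χ(p)(1 + p)`, `ρ̄_{f,𝔫}^{ss} ≅ χ ⊕ χω_n` is
reducible and is not the mod-`n` representation of a Frey curve".

* `NewformModel.EisChiPackage` — **CITED NAMED HYPOTHESIS**, the character-family analogue of
  `NewformModel.EisPackage`: if `ρ^E_n` (standing datum) arises from the newform `f` of level `N`, then for the prime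
  `ν ∣ n` in question — a ring homomorphism `ψ : Coeff f → k` to a field of characteristic `n` — (i) `ψ(c_ℓ) ∈
  bs04Allowed ℓ` for all odd primes `ℓ ∤ nN` [BS04, (3.1) p. 31 + Lemma 4.2], AND (ii-χ) `f` is NOT congruent under
  `ψ`, up to a `B` reaching the weight-2 Sturm bound of `Γ₀(N)`, to any `G_λ = Σ_t λ_t E_χ(tz)` with `χ = (·/C)`,
  `C` an odd prime, `C² ∣ N`, `t·C² ∣ N` (`M.EisensteinChiCongruent`, file `Sieve/EisensteinChi.lean`; checked by `EisChiCertF.check` of `Sieve/EisensteinChiFast.lean`). Printed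
  inputs for (ii-χ): `E₂^{χ,χ} ∈ M₂(Γ₀(C²))` (trivial character `χ² = 1`) with `q`-expansion
  `2 Σ σ₁^{χ,χ}(m) q^m`, zero constant term, `T_p`-eigenvalue `χ(p)(1 + p)` [DS05, Thm. 4.5.1, §4.6/Thm. 4.6.2,
  Prop. 5.2.3]; [Sturm 1987, Thm. 1] (congruence of two weight-2 forms on `Γ₀(N)` beyond index `[SL₂(ℤ):Γ₀(N)]/6`
  is congruence) — so `1 = a_1(f) ≡ a_1(G_λ)` and `c_p(f) ≡ χ(p)(1 + p) (mod ν)` for every prime `p ∤ N`; by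
  Chebotarev and Brauer–Nesbitt `ρ̄_{f,ν}^{ss} ≅ χ ⊕ χ·ω_n` ([DS05, Thm. 9.6.6] on the Eisenstein side) is
  REDUCIBLE — contradicting the absolute irreducibility of `ρ^E_n` for `n ≥ 7`, `ab ≠ ±1` [BS04, Cor. 3.1] (with the
  printed caveat at `n = 7` of Bennett–Vatsal–Yazdani 2004 carried as for `BS04Package`). CITED, never proved
  here; rows take `(hEχ : M.EisChiPackage)`.
* `M6ChiCert`, `M6ChiCert.check` (Boolean, `decide`) and **THEOREM `NewformModel.excludesStd_of_m6chi`**: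
  `EisChiPackage` + `Refines N o c.X` (COMPUTED, as in `EisPackage.lean`) + a passing certificate ⇒
  `M.ExcludesStd N o c.E.n`. The certificate has the same three kernel-checked parts as an `M6Cert`: the character
  Eisenstein congruence at `θ ↦ r` (`EisChiCertF.check`, the factorisation-based checker of `Sieve/EisensteinChiFast.lean`); an identity `F = (X − r)^e·H + n·Q` in `ℤ[X]`
  (`splitPowCheck`; `e ≥ 1` is the multiplicity of the root `r` of `F mod n` — the cell's reading M6-t-MULTIPLE,
  lead ruling A9d: four of the six row-relevant M6χ residues are multiple roots, and removing ALL factors `X − r`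
  is what lets the relative sieve ignore the realisation `θ ↦ r`); and an ordinary sieve certificate (`OrbitCert`)
  for the data `o` with `F` replaced by `H`, which kills every realisation `φ` with `φ(X) ≠ r` by clause (i).
* `M6PowCert`, **THEOREM `NewformModel.excludesStd_of_m6pow`** — the same for the TRIVIAL-character module M6 of
  `Recipes/EisPackage.lean` (hypothesis `EisPackage`, unchanged), with the fast checker `EisCertF` of
  `Sieve/EisensteinFast.lean` and the multiplicity-aware splitting: needed for the M6 residues of the A11-1 rows at
  levels 1058 (`1058.11 @ 11`, a quintuple root), 4418 and 5618 (`B = 1128, 1431`).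
* `linPowL`, `splitPowCheck`, `splitPowCheck_kills` — `(X − r)^e` on coefficient lists, the Boolean identity check,
  and: `φ(F) = 0`, `φ(X) ≠ r` in a field of characteristic `n` ⇒ `φ(H) = 0`.

References: Diamond–Shurman, GTM 228 (2005), Thm. 4.5.1, §4.6, Prop. 5.2.3, Prop. 5.8.5, Thm. 9.6.6; J. Sturm, LNM
1240 (1987), Thm. 1; [BS04] Bennett–Skinner, Canad. J. Math. 56 (2004), (3.1), Lemma 4.2, Cor. 3.1. Cell records as
in `Sieve/EisensteinChi.lean`.
-/

namespace Summit.Ventures.AbcSig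

open Polynomial

/-! ## The named hypothesis -/

/-- **NAMED HYPOTHESIS (CITED) — [BS04, (3.1) + Lemma 4.2 + Cor. 3.1] with [Sturm 1987, Thm. 1] and [DS05, Thm.
4.5.1/§4.6, Prop. 5.2.3, Thm. 9.6.6].** For a standing datum `S` (exponent `n`) and a newform `f` of level `N` from
which `ρ^E_n` arises there is a ring homomorphism `ψ : Coeff f → k` to a field of characteristic `n` (reduction
modulo the prime `ν ∣ n` of [BS04, p. 31]) with (i) `ψ(c_ℓ(f)) ∈ bs04Allowed ℓ` for every odd prime `ℓ ≠ n`,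
`ℓ ∤ N`, and (ii-χ) for every odd prime `C` with `C² ∣ N`, every combination `λ` of the `E_χ(tz)` (`t·C² ∣ N`,
`χ = (·/C)`) and every `B` reaching the weight-2 Sturm bound of `Γ₀(N)`, `f` is NOT congruent to `G_λ` under `ψ` up
to `q^B` (else `ρ̄_{f,ν}^{ss} ≅ χ ⊕ χω_n` would be reducible, contradicting Cor. 3.1). See the module docstring. -/
def NewformModel.EisChiPackage (M : NewformModel) : Prop :=
  ∀ (S : FreyDatum) (κ : FreyCase), Standing S κ →
    ∀ (N : ℕ) (f : M.Form N), M.Arises S N f →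
      ∃ (k : Type) (_ : Field k) (_ : CharP k S.n) (ψ : M.Coeff N f →+* k),
        (∀ ℓ : ℕ, ℓ.Prime → ℓ ≠ 2 → ℓ ≠ S.n → ¬ ℓ ∣ N → ∃ t ∈ bs04Allowed ℓ, ψ (M.eig N f ℓ) = (t : k)) ∧
        ∀ (C : ℕ) (lam : List (ℕ × ℤ)) (B : ℕ), SturmReaches N B → ¬ M.EisensteinChiCongruent f ψ C lam B

/-! ## Splitting off all factors `X − r`: `F = (X − r)^e·H + n·Q` -/

/-- `(X − r)^e` as a little-endian coefficient list. -/
def linPowL (r : ℤ) : ℕ → List ℤ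
  | 0 => [1]
  | e + 1 => mulL [-r, 1] (linPowL r e)

/-- `toPoly (linPowL r e) = (X − C r)^e`. -/
lemma toPoly_linPowL (r : ℤ) : ∀ e : ℕ, toPoly (linPowL r e) = (X - C r) ^ e
  | 0 => by simp [linPowL, toPoly_cons]
  | e + 1 => by
      rw [linPowL, toPoly_mulL, toPoly_linPowL r e, pow_succ]
      have : toPoly [-r, 1] = X - C r := by
        simp only [toPoly_cons, toPoly_nil, mul_zero, add_zero, map_neg, C_1, mul_one]
        ring
      rw [this]; ring

/-- Boolean check of the polynomial identity `F = (X − r)^e·H + n·Q` on coefficient lists. -/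
def splitPowCheck (F H Q : List ℤ) (r : ℤ) (n e : ℕ) : Bool :=
  isZeroL (addL (addL (mulL (linPowL r e) H) (smulL (n : ℤ) Q)) (smulL (-1) F))

/-- If `F = (X − r)^e·H + n·Q` then every `φ : ℤ[X] → k` into a field of characteristic `n` with `φ(F) = 0` and
`φ(X) ≠ r` kills `H`. -/
theorem splitPowCheck_kills {F H Q : List ℤ} {r : ℤ} {n e : ℕ} (h : splitPowCheck F H Q r n e = true) {k : Type}
    [Field k] [CharP k n] (φ : ℤ[X] →+* k) (hF : φ (toPoly F) = 0) (hX : φ X ≠ (r : k)) : φ (toPoly H) = 0 := by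
  have h0 := toPoly_eq_zero_of_isZeroL _ h
  rw [toPoly_addL, toPoly_addL, toPoly_mulL, toPoly_smulL, toPoly_smulL, toPoly_linPowL] at h0
  have hn : φ (C (n : ℤ)) = 0 := by
    rw [map_natCast C n, map_natCast φ n]
    exact CharP.cast_eq_zero k n
  have hC : ∀ z : ℤ, φ (C z) = (z : k) := fun z =>
    (RingHom.comp_apply φ C z).symm.trans (eq_intCast (φ.comp C) z)
  have hlin : φ ((X - C r) ^ e) = (φ X - (r : k)) ^ e := by
    rw [map_pow, map_sub, hC]
  have h1 := congrArg φ h0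
  simp only [map_add, map_mul, map_zero, hF, hn, mul_zero, zero_mul, add_zero, hlin] at h1
  rcases mul_eq_zero.mp h1 with h3 | h3
  · exact absurd (sub_eq_zero.mp (pow_eq_zero_iff'.mp h3).1) hX
  · exact h3

/-! ## M6χ certificates and the discharge theorem -/

/-- A module-M6χ certificate for the orbit data `o` at the exponent `E.n`: extended data `X`, the character
Eisenstein certificate `E` (prime `(E.n, θ − E.r)`, character `(·/E.C)`), the multiplicity `e` and cofactors of
`F = (X − r)^e·H + n·Q`, and an ordinary sieve certificate `certH` for `o` with `F` replaced by `H`. -/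
structure M6ChiCert where
  /-- extended orbit data (entries at every prime `p ≤ B`) -/
  X : OrbitData
  /-- the character Eisenstein-congruence certificate (fast format, `Sieve/EisensteinChiFast.lean`) -/
  E : EisChiCertF
  /-- multiplicity `e ≥ 1` of the root `r` of `F mod n` -/
  e : ℕ
  /-- `H` with `F = (X − r)^e·H + n·Q` -/
  H : List ℤ
  /-- `Q` with `F = (X − r)^e·H + n·Q` -/
  Q : List ℤ
  /-- sieve certificate for `{F := H, coeffs := o.coeffs}` -/
  certH : OrbitCert

/-- The orbit data with `F` replaced by the cofactor `H` (realisations avoiding `θ ↦ r`). -/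
def M6ChiCert.oH (c : M6ChiCert) (o : OrbitData) : OrbitData := { F := c.H, coeffs := o.coeffs }

/-- **M6χ check** (Boolean): character Eisenstein congruence (`EisChiCertF.check`), the splitting identity, the
relative sieve certificate, and `n` not among its bases. -/
def M6ChiCert.check (c : M6ChiCert) (N : ℕ) (o : OrbitData) : Bool :=
  c.E.check N c.X && splitPowCheck o.F c.H c.Q c.E.r c.E.n c.e && c.certH.check (c.oH o) bs04Allowed &&
    !((c.certH.fac.map Prod.fst).contains c.E.n)

/-- **Discharge of an M6χ orbit.** `EisChiPackage` (CITED) + `Refines N o c.X` (COMPUTED) + a passing `M6ChiCert`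
(KERNEL) + well-formed sieve entries ⇒ `M.ExcludesStd N o c.E.n`. Proof (verbatim the M6 one): for a standing `S`
with `S.n = n` and `f` matching `o` via `θ`, `EisChiPackage` yields `ψ`; if `ψ(θ) = r` the character Eisenstein
certificate contradicts (ii-χ); otherwise `φ = ψ ∘ (X ↦ θ)` kills `H` (splitting identity, `(ψ(θ) − r)^e ≠ 0` in `k`)
and realises `{F := H, coeffs := o.coeffs}` with allowed traces by (i), which the relative sieve certificate forbids. -/
theorem NewformModel.excludesStd_of_m6chi (M : NewformModel) (hE : M.EisChiPackage) {N : ℕ} (o : OrbitData)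
    (c : M6ChiCert) (hwf : ∀ e ∈ o.coeffs, e.ell.Prime ∧ e.ell ≠ 2 ∧ ¬ e.ell ∣ N) (hRef : M.Refines N o c.X)
    (hc : c.check N o = true) : M.ExcludesStd N o c.E.n := by
  simp only [M6ChiCert.check, Bool.and_eq_true, Bool.not_eq_true'] at hc
  obtain ⟨⟨⟨hEis, hsplit⟩, hcert⟩, hbase⟩ := hc
  have hbase' : c.E.n ∉ c.certH.fac.map Prod.fst := by
    intro hm
    have : (c.certH.fac.map Prod.fst).contains c.E.n = true := List.contains_iff_mem.mpr hm
    rw [this] at hbase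
    exact Bool.noConfusion hbase
  intro S κ hS hn f hfo harises
  obtain ⟨hA, hB, hC, hsq, hprime, h7, hndvd, hfree, hsol, hab1, hab2, hcase⟩ := hS
  obtain ⟨θ, hF, hco⟩ := hfo
  obtain ⟨k, hk, hchar, ψ, hallowed, hnoteis⟩ :=
    hE S κ ⟨hA, hB, hC, hsq, hprime, h7, hndvd, hfree, hsol, hab1, hab2, hcase⟩ N f harises
  have hchar' : CharP k c.E.n := hn ▸ hchar
  by_cases hr : ψ θ = (c.E.r : k)
  · obtain ⟨hcong, hsturm⟩ := c.E.check_sound c.X hEis M f θ (hRef f θ hF hco) ψ hr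
    exact hnoteis c.E.C c.E.lam c.E.B hsturm hcong
  · let φ : ℤ[X] →+* k := ψ.comp (Polynomial.eval₂RingHom (Int.castRingHom (M.Coeff N f)) θ)
    have hφ : ∀ P : List ℤ, φ (toPoly P) = ψ (evalL θ P) := fun P => rfl
    have hφF : φ (toPoly o.F) = 0 := by rw [hφ, hF, map_zero]
    have hφX : φ X = ψ θ := by
      show ψ (Polynomial.eval₂ (Int.castRingHom (M.Coeff N f)) θ X) = ψ θ
      rw [eval₂_X]
    have hH : φ (toPoly c.H) = 0 := splitPowCheck_kills hsplit φ hφF (by rwa [hφX])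
    have helim : (c.oH o).Eliminated bs04Allowed c.E.n :=
      c.certH.check_sound (c.oH o) bs04Allowed hcert c.E.n (hn ▸ hprime) hbase'
    refine helim k φ ⟨hH, ?_⟩
    intro e he hne
    obtain ⟨hp, h2, hNe⟩ := hwf e he
    obtain ⟨t, ht, hψt⟩ := hallowed e.ell hp h2 (by rw [hn]; exact hne) hNe
    refine ⟨t, ht, ?_⟩
    show φ (toPoly e.g) = _
    rw [hφ, ← hco e he, map_mul, hψt, map_intCast]

/-! ## Module M6 (trivial character) at the cell's big levels: fast certificate, multiple roots -/

/-- A module-M6 certificate in the FAST format with the multiplicity-aware splitting: extended data `X`, the fast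
Eisenstein certificate `E : EisCertF` (`Sieve/EisensteinFast.lean`), `e`, `H`, `Q` with `F = (X − r)^e·H + n·Q`, and
the relative sieve certificate. (`Recipes/EisPackage.lean`'s `M6Cert` is the case `e = 1` with the slow checker.) -/
structure M6PowCert where
  /-- extended orbit data (entries at every prime `p ≤ B`) -/
  X : OrbitData
  /-- the Eisenstein-congruence certificate (fast format) -/
  E : EisCertF
  /-- multiplicity `e ≥ 1` of the root `r` of `F mod n` -/
  e : ℕ
  /-- `H` with `F = (X − r)^e·H + n·Q` -/
  H : List ℤ
  /-- `Q` with `F = (X − r)^e·H + n·Q` -/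
  Q : List ℤ
  /-- sieve certificate for `{F := H, coeffs := o.coeffs}` -/
  certH : OrbitCert

/-- The orbit data with `F` replaced by the cofactor `H`. -/
def M6PowCert.oH (c : M6PowCert) (o : OrbitData) : OrbitData := { F := c.H, coeffs := o.coeffs }

/-- **M6 check, fast/multiple-root form** (Boolean). -/
def M6PowCert.check (c : M6PowCert) (N : ℕ) (o : OrbitData) : Bool :=
  c.E.check N c.X && splitPowCheck o.F c.H c.Q c.E.r c.E.n c.e && c.certH.check (c.oH o) bs04Allowed &&
    !((c.certH.fac.map Prod.fst).contains c.E.n)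

/-- **Discharge of an M6 orbit (fast certificate, multiple roots allowed).** `EisPackage` (CITED, `Recipes/EisPackage.lean`)
+ `Refines N o c.X` (COMPUTED) + a passing `M6PowCert` (KERNEL) + well-formed sieve entries ⇒ `M.ExcludesStd N o c.E.n`.
Same proof as `NewformModel.excludesStd_of_m6`, with `EisCertF.check_sound` and `splitPowCheck_kills`. -/
theorem NewformModel.excludesStd_of_m6pow (M : NewformModel) (hE : M.EisPackage) {N : ℕ} (o : OrbitData)
    (c : M6PowCert) (hwf : ∀ e ∈ o.coeffs, e.ell.Prime ∧ e.ell ≠ 2 ∧ ¬ e.ell ∣ N) (hRef : M.Refines N o c.X)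
    (hc : c.check N o = true) : M.ExcludesStd N o c.E.n := by
  simp only [M6PowCert.check, Bool.and_eq_true, Bool.not_eq_true'] at hc
  obtain ⟨⟨⟨hEis, hsplit⟩, hcert⟩, hbase⟩ := hc
  have hbase' : c.E.n ∉ c.certH.fac.map Prod.fst := by
    intro hm
    have : (c.certH.fac.map Prod.fst).contains c.E.n = true := List.contains_iff_mem.mpr hm
    rw [this] at hbase
    exact Bool.noConfusion hbase
  intro S κ hS hn f hfo harises
  obtain ⟨hA, hB, hC, hsq, hprime, h7, hndvd, hfree, hsol, hab1, hab2, hcase⟩ := hS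
  obtain ⟨θ, hF, hco⟩ := hfo
  obtain ⟨k, hk, hchar, ψ, hallowed, hnoteis⟩ :=
    hE S κ ⟨hA, hB, hC, hsq, hprime, h7, hndvd, hfree, hsol, hab1, hab2, hcase⟩ N f harises
  have hchar' : CharP k c.E.n := hn ▸ hchar
  by_cases hr : ψ θ = (c.E.r : k)
  · obtain ⟨hcong, hsturm⟩ := c.E.check_sound c.X hEis M f θ (hRef f θ hF hco) ψ hr
    exact hnoteis c.E.lam c.E.B hsturm hcong
  · let φ : ℤ[X] →+* k := ψ.comp (Polynomial.eval₂RingHom (Int.castRingHom (M.Coeff N f)) θ)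
    have hφ : ∀ P : List ℤ, φ (toPoly P) = ψ (evalL θ P) := fun P => rfl
    have hφF : φ (toPoly o.F) = 0 := by rw [hφ, hF, map_zero]
    have hφX : φ X = ψ θ := by
      show ψ (Polynomial.eval₂ (Int.castRingHom (M.Coeff N f)) θ X) = ψ θ
      rw [eval₂_X]
    have hH : φ (toPoly c.H) = 0 := splitPowCheck_kills hsplit φ hφF (by rwa [hφX])
    have helim : (c.oH o).Eliminated bs04Allowed c.E.n :=
      c.certH.check_sound (c.oH o) bs04Allowed hcert c.E.n (hn ▸ hprime) hbase'
    refine helim k φ ⟨hH, ?_⟩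
    intro e he hne
    obtain ⟨hp, h2, hNe⟩ := hwf e he
    obtain ⟨t, ht, hψt⟩ := hallowed e.ell hp h2 (by rw [hn]; exact hne) hNe
    refine ⟨t, ht, ?_⟩
    show φ (toPoly e.g) = _
    rw [hφ, ← hco e he, map_mul, hψt, map_intCast]

end Summit.Ventures.AbcSig
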